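/-
Origin: expansion seat `planner-pub-hodgecm-mc-axioms-1-g14-0`, handover #W63 2026-08-20T15:53:55Z md5 7fe10b75dc2f (PKG 352fd93c1e8e → 7fe10b75dc2f; 165 l.; MECHANICAL (iib-R) rewrite v3.1 of the PKG file as it stands (14 token edits; rules R1x1+RX[h₂']x13)) (`HOME/mc/pub-hodgecm-mc-axioms-1-g14/revendor/kit-r55/stage55/HodgeCM/Model/ArchKTypeOfAtCoset.lean`, md5 7fe10b75dc2f, 165 lines);
landed by the gen-22 packager (p-g22) in gate run 55 REPLACES the earlier landed copy of `HodgeCM/Model/ArchKTypeOfAtCoset.lean` (seat copy carried the packager Origin header of an earlier run (stripped)).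
-/
/-
Copyright (c) 2026. Released under Apache 2.0 license as described in the file LICENSE.
Cell pub-hodgecm, MODEL layer (construction prover mc-carch-1, gen 4), BINDER-OWNERS row 12 `C` in binder-1's CENTRE-FREE currency,
general thin cosets: `archKTypeOfAtCoset … xc 𝔫` (binder-1-g12's currency gap (a), l.13190).
-/
import Summits.HodgeConjecture.HodgeCM.Model.ArchKTypeOfAt

/-!
# The archimedean `K`-type datum AT AN ARBITRARY THIN COSET `xc + 𝔫𝒪̂³`: `archKTypeOfAtCoset`

RUN-48 #CA42 `archKTypeOfAt` is typed at rational centres `finEmb xr` and principal levels `(N)`; binder-1's (W-0-fin) (#52/#53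
`span_cosetIndicatorSB_eq_top`) quantifies over ALL finite-adelic centres `xc : Fin 3 → 𝔸_{L⁺,f}` and ALL ideals `𝔫`.  This leaf is
the same constructor at `(xc, 𝔫)`: `apply_thinCosetTestFunₗ_of_eq_adelicTensorEnd` (the product identity at any thin coset),
**`archKTypeOfAtCoset S hV k xc 𝔫 Γ₀ K hK hlevel hsat ωA hA Φarch hfix harm : ArchKTypeDataAt (thetaSpaceInputIn … S hV) k xc 𝔫`**
(`ωinf := ωA`, `fixN := hfix` at the coset, `prodN` the product identity), its field lemmas and the rows-14/15 transfers
(hypotheses on `(ωA, Φarch)` only; `…_of_eq` from any x₀-pinned datum with the same archimedean pair).  #CA42's term is the case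
`(finEmb xr, span {N})` (same fields, `rfl`).
Nothing is cited and nothing is minted; 0 records, 0 `def … : Prop`.
-/

set_option autoImplicit false

noncomputable section

open Filter Topology Complex
open scoped Classical SchwartzMap
open MulAction NumberField NumberField.mixedEmbedding IsDedekindDomain
open Literature.NumberTheory.Automorphic Literature.NumberTheory.Automorphic.UnitaryGroup Literature.NumberTheory.Weil1964
open Literature.Analysis.SegalBargmann
open Literature.AlgebraicGeometry.HodgeTheory
open Literature.AlgebraicGeometry.ShimuraVarieties Literature.AlgebraicGeometry.ShimuraVarieties.BallForms
open Literature.Geometry.ComplexHyperbolic.BallModel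
open Literature.RepresentationTheory.KonnoKonno2007 Literature.RepresentationTheory.KonnoKonno2007.RealDualPair
open Literature.NumberTheory.Automorphic.PicardCM Literature.Analysis.Distribution
open Literature.RepresentationTheory.HeisenbergGroup
open HodgeCM.PerL34.Seesaw HodgeCM.PerL34.RationalCoset HodgeCM.PerL34.SupplyAdelic
open HodgeCM.Model.SupplyInstance HodgeCM.Model.SupplyResidual
open HodgeCM.Model.ThetaSpace

namespace HodgeCM
namespace Model

/-- `(A ⊗ 1)(Φ_∞ ⊗ 1_{xc + 𝔫𝒪̂}) = (A Φ_∞) ⊗ 1_{xc + 𝔫𝒪̂}` at EVERY finite-adelic centre `xc` and level ideal `𝔫` (tree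
`thinCosetTestFunₗ_eq_tmul`; #CA2's `apply_testFun_of_eq_adelicTensorEnd` is the case `(finEmb x, (N))`). -/
theorem apply_thinCosetTestFunₗ_of_eq_adelicTensorEnd {K : Type} [Field K] [NumberField K] {J : Type} [Fintype J]
    {G : Type} [Group G] {ρ : Representation ℂ G (piSchwartzBruhat K J)} {g : G}
    {A : 𝓢((J → mixedSpace K), ℂ) →ₗ[ℂ] 𝓢((J → mixedSpace K), ℂ)} (hA : ρ g = adelicTensorEnd A LinearMap.id)
    (Φinf : 𝓢((J → mixedSpace K), ℂ)) (xc : J → FiniteAdeleRing (𝓞 K) K) (𝔫 : Ideal (𝓞 K)) :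
    ρ g (thinCosetTestFunₗ (K := K) (ι := J) xc 𝔫 Φinf) = thinCosetTestFunₗ (K := K) (ι := J) xc 𝔫 (A Φinf) := by
  rw [thinCosetTestFunₗ_eq_tmul, thinCosetTestFunₗ_eq_tmul, hA, adelicTensorEnd_apply_tmul, LinearMap.id_apply]

/-! ## The constructor at an arbitrary thin coset `xc + 𝔫𝒪̂³` -/

section Pin

variable (hHD : exists_isReal_hodgeModel) (hI : hodgePQ_independent_of_hodgeModel)
  (h₁ : BallQuotientUniformised)  (h₃ : CMAbelianVarietyRealised)

variable {L : CMField} {ι₁ : L →+* ℂ} {V : HermSpace3 L ι₁} {c : SeesawCtx L}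

variable (S : ThetaAdelicSide V c) (hV : IsAnisotropic L V.Hm) (k : Fin 4) (xc : Fin 3 → FiniteAdeleRing (𝓞 ↥(maximalRealSubfield L)) ↥(maximalRealSubfield L))
  (𝔫 : Ideal (𝓞 ↥(maximalRealSubfield L))) (Γ₀ : Level V)
  (K : Subgroup (UnitaryGroup.finAdelic (↥(maximalRealSubfield L)) L (IsCMField.complexConj L) 3 V.Hm))
  (hK : (satLevelRegimeOf V hV K : Subgroup (V.latticeModel printFact_unitaryCompact_holds).G) ≤ S.Gfin)
  (hlevel : ∀ δ ∈ levelImage hHD hI h₁ h₃ Γ₀ hV, ∃ y : (V.latticeModel printFact_unitaryCompact_holds).G,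
    y ∈ (satLevelRegimeOf V hV K : Subgroup (V.latticeModel printFact_unitaryCompact_holds).G) ∧
      S.ιinf δ * y ∈ (V.latticeModel printFact_unitaryCompact_holds).Γ)
  (hsat : ∀ g ∈ (thetaSpaceInputIn hHD hI h₁ h₃ S hV).KΓ Γ₀,
    g ∈ (satLevelRegimeOf V hV K : Subgroup (V.latticeModel printFact_unitaryCompact_holds).G))
  (ωA : Representation ℂ U21 𝓢((Fin 3 → mixedSpace (↥(maximalRealSubfield L))), ℂ))
  (hA : ∀ g : U21, (S.P k).ω (S.ιinf g, 1) =
    adelicTensorEnd (K := ↥(maximalRealSubfield L)) (ι := Fin 3) (ωA g) LinearMap.id)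
  (Φarch : Module.Dual ℂ (Fin 2 → ℂ) →ₗ[ℂ] 𝓢((Fin 3 → mixedSpace (↥(maximalRealSubfield L))), ℂ))
  (hfix : ∀ y : (V.latticeModel printFact_unitaryCompact_holds).G,
    y ∈ (satLevelRegimeOf V hV K : Subgroup (V.latticeModel printFact_unitaryCompact_holds).G) →
    ∀ ℓ : Module.Dual ℂ (Fin 2 → ℂ),
    (S.P k).ω (y, 1) (thinCosetTestFunₗ (K := ↥(maximalRealSubfield L)) (ι := Fin 3) xc 𝔫 (Φarch ℓ)) =
      thinCosetTestFunₗ (K := ↥(maximalRealSubfield L)) (ι := Fin 3) xc 𝔫 (Φarch ℓ))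
  (harm : ∀ (u : ↥(stabilizer U21 x₀)) (ℓ : Module.Dual ℂ (Fin 2 → ℂ)),
    ωA (u : U21) (Φarch ℓ) = Φarch ((BallForms.isPullbackCocycle_cotangentCocycle.weightOf x₀).dual u ℓ))

/-- **The archimedean `K`-type datum AT THE PIN, AT THE THIN COSET `xc + 𝔫𝒪̂³`** (binder-1's currency `ArchKTypeDataAt`, ANY finite-adelic
centre `xc` and ANY level ideal `𝔫`): finite `K`-type `satLevelRegimeOf V hV K`, `ωinf := ωA` the pure-tensor archimedean factor (`hA`), harmonic family
`Φarch`; hypotheses = the named junctions `hK`/`hlevel`/`hsat` (level), `hA` (product structure), `hfix` ((W-Kf′) at `x`), `harm` ((W-K∞′)). -/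
def archKTypeOfAtCoset :
    ArchKTypeDataAt (thetaSpaceInputIn hHD hI h₁ h₃ S hV) k xc 𝔫 where
  Γ₀ := Γ₀
  K₂ := ↥(satLevelRegimeOf V hV K)
  κ₂ := (satLevelRegimeOf V hV K).subtype
  comm m g := S.comm_fin g m.1 (hK m.2)
  level δ hδ := by
    obtain ⟨y, hy, h⟩ := hlevel δ hδ
    refine ⟨⟨y, hy⟩, ?_⟩
    show S.ιinf δ * y ∈ (S.P k).ΓU
    rw [S.hΓU k]
    exact h
  sat g hg := ⟨⟨g, hsat g hg⟩, rfl⟩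
  Φarch := Φarch
  ωinf := ωA
  fixN m ℓ := hfix m.1 m.2 ℓ
  prodN g Φinf := apply_thinCosetTestFunₗ_of_eq_adelicTensorEnd (hA g) Φinf xc 𝔫
  harm u ℓ := harm u ℓ

/-- (Ported verbatim from the HodgeCMPerL package; no docstring in the source.) -/
@[simp] theorem archKTypeOfAtCoset_Γ₀ :
    (archKTypeOfAtCoset hHD hI h₁ h₃ S hV k xc 𝔫 Γ₀ K hK hlevel hsat ωA hA Φarch hfix harm).Γ₀ = Γ₀ := rfl

/-- (Ported verbatim from the HodgeCMPerL package; no docstring in the source.) -/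
@[simp] theorem archKTypeOfAtCoset_Φarch :
    (archKTypeOfAtCoset hHD hI h₁ h₃ S hV k xc 𝔫 Γ₀ K hK hlevel hsat ωA hA Φarch hfix harm).Φarch = Φarch := rfl

/-- (Ported verbatim from the HodgeCMPerL package; no docstring in the source.) -/
@[simp] theorem archKTypeOfAtCoset_ωinf :
    (archKTypeOfAtCoset hHD hI h₁ h₃ S hV k xc 𝔫 Γ₀ K hK hlevel hsat ωA hA Φarch hfix harm).ωinf = ωA := rfl

/-- the adelic family of the term: `Φfam ℓ = Φarch ℓ ⊗ 1_{xc + 𝔫𝒪̂}`. -/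
theorem archKTypeOfAtCoset_Φfam (ℓ : Module.Dual ℂ (Fin 2 → ℂ)) :
    (archKTypeOfAtCoset hHD hI h₁ h₃ S hV k xc 𝔫 Γ₀ K hK hlevel hsat ωA hA Φarch hfix harm).Φfam ℓ =
      thinCosetTestFunₗ (K := ↥(maximalRealSubfield L)) (ι := Fin 3) xc 𝔫 (Φarch ℓ) := rfl

/-- **(AN) for the term ⇐ (AN) of `(ωA, Φarch)` along `e`.** -/
theorem isWeaklyPDiff_archKTypeOfAtCoset {P' : Type*} [NormedAddCommGroup P'] [NormedSpace ℝ P'] (e : P' → U21)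
    (h : ∀ (T : 𝓢((Fin 3 → mixedSpace (↥(maximalRealSubfield L))), ℂ) →L[ℂ] ℂ) (ℓ : Module.Dual ℂ (Fin 2 → ℂ)),
      DifferentiableAt ℝ (fun b => T (ωA (e b) (Φarch ℓ))) 0) :
    (archKTypeOfAtCoset hHD hI h₁ h₃ S hV k xc 𝔫 Γ₀ K hK hlevel hsat ωA hA Φarch hfix harm).IsWeaklyPDiff e :=
  fun T ℓ => h T ℓ

/-- **(REP) along `v` for the term ⇐ the p⁻-limits of `(ωA, Φarch)`.** -/
theorem isPMinusKilledAlong_archKTypeOfAtCoset {P' : Type*} [NormedAddCommGroup P'] [NormedSpace ℝ P'] [Module ℂ P']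
    (e : P' → U21) (v : P')
    (h : ∀ ℓ : Module.Dual ℂ (Fin 2 → ℂ), ∃ D Dᵢ : 𝓢((Fin 3 → mixedSpace (↥(maximalRealSubfield L))), ℂ),
      Tendsto (fun t : ℝ => t⁻¹ • (ωA (e (t • v)) (Φarch ℓ) - Φarch ℓ)) (𝓝[≠] 0) (𝓝 D) ∧
        Tendsto (fun t : ℝ => t⁻¹ • (ωA (e (t • (Complex.I • v))) (Φarch ℓ) - Φarch ℓ)) (𝓝[≠] 0) (𝓝 Dᵢ) ∧
          D + Complex.I • Dᵢ = 0) :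
    (archKTypeOfAtCoset hHD hI h₁ h₃ S hV k xc 𝔫 Γ₀ K hK hlevel hsat ωA hA Φarch hfix harm).IsPMinusKilledAlong e v :=
  fun ℓ => h ℓ

/-- **rows 14/15 TRANSFER from any x₀-pinned datum with the same archimedean pair** `(ωinf, Φarch) = (ωA, Φarch)` (e.g. the
RUN-43/45 `archKTypeOfSide…G` terms): the three archimedean predicates do not see the centre. -/
theorem isWeaklyPDiff_archKTypeOfAtCoset_of_eq {N' : ℕ} (C : ArchKTypeData (thetaSpaceInputIn hHD hI h₁ h₃ S hV) k N')
    (hω : ∀ g Φ, C.ωinf g Φ = ωA g Φ) (hΦ : ∀ ℓ, C.Φarch ℓ = Φarch ℓ)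
    {P' : Type*} [NormedAddCommGroup P'] [NormedSpace ℝ P'] (e : P' → U21) (h : C.IsWeaklyPDiff e) :
    (archKTypeOfAtCoset hHD hI h₁ h₃ S hV k xc 𝔫 Γ₀ K hK hlevel hsat ωA hA Φarch hfix harm).IsWeaklyPDiff e :=
  fun T ℓ => by
    have h' := h T ℓ
    simp only [hω, hΦ] at h'
    exact h'

/-- (Ported verbatim from the HodgeCMPerL package; no docstring in the source.) -/
theorem isPMinusKilledAlong_archKTypeOfAtCoset_of_eq {N' : ℕ} (C : ArchKTypeData (thetaSpaceInputIn hHD hI h₁ h₃ S hV) k N')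
    (hω : ∀ g Φ, C.ωinf g Φ = ωA g Φ) (hΦ : ∀ ℓ, C.Φarch ℓ = Φarch ℓ)
    {P' : Type*} [NormedAddCommGroup P'] [NormedSpace ℝ P'] [Module ℂ P'] (e : P' → U21) (v : P')
    (h : C.IsPMinusKilledAlong e v) :
    (archKTypeOfAtCoset hHD hI h₁ h₃ S hV k xc 𝔫 Γ₀ K hK hlevel hsat ωA hA Φarch hfix harm).IsPMinusKilledAlong e v :=
  fun ℓ => by
    obtain ⟨D, Dᵢ, hD, hDᵢ, hsum⟩ := h ℓ
    simp only [hω, hΦ] at hD hDᵢ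
    exact ⟨D, Dᵢ, hD, hDᵢ, hsum⟩

end Pin

end Model
end HodgeCM

end
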